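import Summits.Parity.GeneralizedHardyLittlewood.Theorems.GreenTaoLevelTwoMNTwoQuadraticRecurrent
import Summits.Parity.GeneralizedHardyLittlewood.Theorems.GreenTaoLevelTwoMNTwoLocalQuadratic
import Mathlib.Analysis.Normed.Group.AddCircle

/-!
# Route `GreenTaoLevelTwo`, crux `MNTwo` (stmt-Parity-21276), line `birth`, stub `stub_mnVertical`:
# Lemma 26 "major arcs have small second derivative" (GT 2008b §11), abstract gauge form

Block V5 / H5 of the `stub_mnVertical` census (B. Green, T. Tao, *Quadratic uniformity of the
Möbius function*, Ann. Inst. Fourier 58 (2008) = arXiv:math/0606087, §11, Lemma 26: from the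
conclusion of Proposition 25 — a set `𝒮 ⊆ B_g(0,ρ₁)` of relative density `≳ ρ₁^{3/2}` with
`‖φ''(n,n)‖_{ℝ/ℤ,Q} ≲ ρ₁²` for `n ∈ 𝒮` — to the DIAGONAL MAJOR-ARC PROPERTY
`‖φ''(h,h)‖_{ℝ/ℤ,Q₁} ≲ ‖h‖_g²` for every `h`: "Applying this to `m = hl` for all `l ∈ {1,…,L}`, where
`L := ⌊ρ₁/‖h‖_g⌋`, and then averaging in `L` … by the pigeonhole principle we can find
`n ∈ B_g(0,2ρ₁)` such that `𝔼_{1≤l≤L} 1_𝒮(n+hl) ≳ ρ₁^{3/2}` … a single `q ≲ 1` such that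
`‖qφ''(n+hl,n+hl)‖ ≲ ρ₁²` for `≳ ρ₁^{3/2}L` values of `l` … `qφ''(n+hl,n+hl) = ql²φ''(h,h) + αl + β`
… Lemma (lem4.6) [= Lemma 40] applies … `L ≳ ‖h‖_g^{-1}`, the conclusion follows").

ABSTRACT, def-free form in the vocabulary of `…MNTwoLocalQuadratic` / `…MNTwoDepolarize`: a
nonnegative subadditive definite gauge `ν` (the rotation Bohr gauge `maxᵢ‖nαᵢ‖ + |n|/N` is one),
`φ : ℤ → ℝ/ℤ` locally quadratic on `B(n₀,R)` (eight-point hypothesis),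
`φ''(a,b) = φ(n₀+a+b) − φ(n₀+a) − φ(n₀+b) + φ(n₀)`.  The density hypothesis is stated through a
finite reference set `T ⊆ B(0,2ρ₁)` receiving all the translates `𝒮 − m`, `ν m ≤ ρ₁` (in the
application `T = B_g(0,2ρ₁)`, and `σ#T ≤ #𝒮` is Prop. 25 + Lemma 14 (b)).  The output is exactly
hypothesis `h26` of `…MNTwoDepolarize.depolarize` (Lemma 27), for ALL `h` (for `ν h > ρ₁` the bound
is trivial).  Constants: the non-explicit `A, C` of the tree's inverse Weyl inequality.

* `second_deriv_diag_add`, `second_deriv_diag_progression` — (bilinear):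
  `φ''(n+lh,n+lh) = φ''(n,n) + 2l φ''(h,n) + l² φ''(h,h)`;
* `zsmul_coe_quadratic` — reading the above in `ℝ/ℤ` with real lifts;
* `exists_base_point` — the averaging/pigeonhole step producing `n`;
* `exists_popular_fiber` — pigeonhole of a function into a finite set (on an arbitrary finset);
* `diagonal_major_arc` — **Lemma 26**: `∃ A C`, for all data and all `h`,
  `∃ 1 ≤ q ≤ C Q (Q/σ)^A` with `‖q•φ''(h,h)‖ ≤ C (Q/σ)^A ν(h)²/ρ₁²`.

References: [GreenTao2008QuadraticMobius] arXiv:math/0606087 §11, Lemma 26.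
-/

noncomputable section

open Finset Real

namespace Summit.Parity.GeneralizedHardyLittlewood.GreenTaoLevelTwoMNTwoDiagonalMajorArc

open Summit.Parity.GeneralizedHardyLittlewood.GreenTaoLevelTwoMNTwoLocalQuadratic
  (gauge_nsmul_le second_deriv_add_left second_deriv_comm second_deriv_nsmul_left)
open Summit.Parity.GeneralizedHardyLittlewood.GreenTaoLevelTwoMNTwoQuadraticRecurrent
  (exists_norm_mul_le_of_quadratic_recurrent)

variable {G : Type*} [AddCommGroup G]

/-! ### §1 The second derivative along a diagonal progression -/

/-- **(bilinear) on the diagonal.**  If `ν a + ν b < r`, `3r ≤ R`, then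
`φ''(a+b,a+b) = φ''(a,a) + 2•φ''(b,a) + φ''(b,b)`.
[cite: GreenTao2008QuadraticMobius, §9 eq. (bilinear)] -/
theorem second_deriv_diag_add (ν : ℤ → ℝ) (hν0 : ν 0 = 0) (hνnn : ∀ x, 0 ≤ ν x)
    (hνadd : ∀ x y, ν (x + y) ≤ ν x + ν y) (φ : ℤ → G) {n₀ : ℤ} {R : ℝ}
    (hφ : ∀ n a b c : ℤ, ν (n - n₀) < R → ν (n + a - n₀) < R → ν (n + b - n₀) < R →
      ν (n + c - n₀) < R → ν (n + a + b - n₀) < R → ν (n + a + c - n₀) < R →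
      ν (n + b + c - n₀) < R → ν (n + a + b + c - n₀) < R →
      φ (n + a + b + c) - φ (n + a + b) - φ (n + a + c) - φ (n + b + c)
        + φ (n + a) + φ (n + b) + φ (n + c) - φ n = 0)
    {a b : ℤ} {r : ℝ} (hab : ν a + ν b < r) (hR : 3 * r ≤ R) :
    φ (n₀ + (a + b) + (a + b)) - φ (n₀ + (a + b)) - φ (n₀ + (a + b)) + φ n₀ =
      (φ (n₀ + a + a) - φ (n₀ + a) - φ (n₀ + a) + φ n₀) +
        2 • (φ (n₀ + b + a) - φ (n₀ + b) - φ (n₀ + a) + φ n₀) +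
        (φ (n₀ + b + b) - φ (n₀ + b) - φ (n₀ + b) + φ n₀) := by
  have ha : ν a < r := by linarith [hνnn b]
  have hb : ν b < r := by linarith [hνnn a]
  have hab' : ν (a + b) < r := lt_of_le_of_lt (hνadd a b) hab
  -- `φ''(a+b, a+b) = φ''(a, a+b) + φ''(b, a+b)`
  rw [second_deriv_add_left ν hν0 hνnn hνadd φ hφ ha hb hab' hR]
  -- `φ''(a, a+b) = φ''(a+b, a) = φ''(a,a) + φ''(b,a)`
  rw [second_deriv_comm φ n₀ a (a + b), second_deriv_add_left ν hν0 hνnn hνadd φ hφ ha hb ha hR]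
  -- `φ''(b, a+b) = φ''(a+b, b) = φ''(a,b) + φ''(b,b)`, `φ''(a,b) = φ''(b,a)`
  rw [second_deriv_comm φ n₀ b (a + b), second_deriv_add_left ν hν0 hνnn hνadd φ hφ ha hb hb hR,
    second_deriv_comm φ n₀ a b, two_nsmul]
  abel

/-- **Explicit quadratic structure on the diagonal (GT 2008b, proof of Lemma 26 via Cor. 20):**
if `ν n + l ν h < r`, `ν h < r`, `3r ≤ R`, then
`φ''(n+lh, n+lh) = φ''(n,n) + (2l)•φ''(h,n) + l²•φ''(h,h)`.
[cite: GreenTao2008QuadraticMobius, §11 (proof of Lemma 26), Corollary 20] -/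
theorem second_deriv_diag_progression (ν : ℤ → ℝ) (hν0 : ν 0 = 0) (hνnn : ∀ x, 0 ≤ ν x)
    (hνadd : ∀ x y, ν (x + y) ≤ ν x + ν y) (φ : ℤ → G) {n₀ : ℤ} {R : ℝ}
    (hφ : ∀ n a b c : ℤ, ν (n - n₀) < R → ν (n + a - n₀) < R → ν (n + b - n₀) < R →
      ν (n + c - n₀) < R → ν (n + a + b - n₀) < R → ν (n + a + c - n₀) < R →
      ν (n + b + c - n₀) < R → ν (n + a + b + c - n₀) < R →
      φ (n + a + b + c) - φ (n + a + b) - φ (n + a + c) - φ (n + b + c)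
        + φ (n + a) + φ (n + b) + φ (n + c) - φ n = 0)
    {n h : ℤ} {r : ℝ} (l : ℕ) (hn : ν n + l * ν h < r) (hh : ν h < r) (hR : 3 * r ≤ R) :
    φ (n₀ + (n + (l : ℤ) * h) + (n + (l : ℤ) * h)) - φ (n₀ + (n + (l : ℤ) * h)) -
        φ (n₀ + (n + (l : ℤ) * h)) + φ n₀ =
      (φ (n₀ + n + n) - φ (n₀ + n) - φ (n₀ + n) + φ n₀) +
        (2 * l) • (φ (n₀ + h + n) - φ (n₀ + h) - φ (n₀ + n) + φ n₀) +
        (l * l) • (φ (n₀ + h + h) - φ (n₀ + h) - φ (n₀ + h) + φ n₀) := by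
  have hνn : 0 ≤ ν n := hνnn n
  have hlh : (l : ℝ) * ν h < r := by linarith
  have hνlh : ν ((l : ℤ) * h) < r := lt_of_le_of_lt (gauge_nsmul_le ν hν0 hνadd h l) hlh
  have hab : ν n + ν ((l : ℤ) * h) < r := by
    have := gauge_nsmul_le ν hν0 hνadd h l; linarith
  have hνn' : ν n < r := by linarith [hνnn ((l : ℤ) * h)]
  rw [second_deriv_diag_add ν hν0 hνnn hνadd φ hφ hab hR]
  -- `φ''(lh, n) = l • φ''(h, n)`
  rw [second_deriv_nsmul_left ν hν0 hνnn hνadd φ hφ l hlh hh hνn' hR]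
  -- `φ''(lh, lh) = l • φ''(h, lh) = l • φ''(lh, h) = l • l • φ''(h,h)`
  rw [second_deriv_nsmul_left ν hν0 hνnn hνadd φ hφ l hlh hh hνlh hR,
    second_deriv_comm φ n₀ h ((l : ℤ) * h),
    second_deriv_nsmul_left ν hν0 hνnn hνadd φ hφ l hlh hh hh hR, mul_nsmul', mul_nsmul']

/-- Reading `q•(γ + (2l)•β + (l·l)•θ)` in `ℝ/ℤ` with real lifts: it is the class of the real
quadratic `(qθ)l² + (2qβ)l + qγ`. [folklore] -/
theorem zsmul_coe_quadratic (q : ℤ) (θ β γ : ℝ) (l : ℕ) :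
    q • (((γ : ℝ) : UnitAddCircle) + (2 * l) • ((β : ℝ) : UnitAddCircle) +
        (l * l) • ((θ : ℝ) : UnitAddCircle)) =
      ((((q : ℝ) * θ) * (l : ℝ) ^ 2 + (2 * (q : ℝ) * β) * l + (q : ℝ) * γ : ℝ) : UnitAddCircle) := by
  rw [← AddCircle.coe_nsmul, ← AddCircle.coe_nsmul, ← AddCircle.coe_add, ← AddCircle.coe_add,
    ← AddCircle.coe_zsmul]
  congr 1
  simp only [nsmul_eq_mul, zsmul_eq_mul]
  push_cast
  ring

/-! ### §2 Averaging and pigeonholes -/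

/-- **The base point (averaging + pigeonhole).**  If for every `l ∈ {1,…,L}` at least `σ#T`
elements `n ∈ T` have `n + lh ∈ 𝒮`, then some `n ∈ T` has `n + lh ∈ 𝒮` for at least `σL`
values of `l ∈ {1,…,L}`. [cite: GreenTao2008QuadraticMobius, §11 (proof of Lemma 26)] -/
theorem exists_base_point {T S : Finset ℤ} (hT : T.Nonempty) (h : ℤ) (L : ℕ) {σ : ℝ}
    (hdens : ∀ l ∈ Icc 1 L, σ * #T ≤ #(T.filter fun n : ℤ => n + (l : ℤ) * h ∈ S)) :
    ∃ n ∈ T, σ * L ≤ #((Icc 1 L).filter fun l : ℕ => n + (l : ℤ) * h ∈ S) := by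
  classical
  by_contra hcon
  push Not at hcon
  have hTpos : (0 : ℝ) < #T := by exact_mod_cast hT.card_pos
  -- double counting
  have key : ∑ n ∈ T, (#((Icc 1 L).filter fun l : ℕ => n + (l : ℤ) * h ∈ S) : ℝ) =
      ∑ l ∈ Icc 1 L, (#(T.filter fun n : ℤ => n + (l : ℤ) * h ∈ S) : ℝ) := by
    simp only [Finset.card_filter]
    push_cast
    exact Finset.sum_comm
  have hlow : σ * #T * L ≤ ∑ l ∈ Icc 1 L, (#(T.filter fun n : ℤ => n + (l : ℤ) * h ∈ S) : ℝ) := by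
    calc σ * #T * L = ∑ _l ∈ Icc 1 L, σ * #T := by
          rw [Finset.sum_const, Nat.card_Icc, nsmul_eq_mul]; push_cast; ring
      _ ≤ _ := Finset.sum_le_sum hdens
  have hup : ∑ n ∈ T, (#((Icc 1 L).filter fun l : ℕ => n + (l : ℤ) * h ∈ S) : ℝ) <
      ∑ _n ∈ T, σ * L := Finset.sum_lt_sum_of_nonempty hT hcon
  rw [Finset.sum_const, nsmul_eq_mul] at hup
  rw [key] at hup
  linarith

/-- **Pigeonhole of a function into a finite set**: if `f` maps `s` into `t ≠ ∅`, some fibre has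
at least `#s/#t` elements. [folklore] -/
theorem exists_popular_fiber {β : Type*} [DecidableEq β] (s : Finset ℕ) (t : Finset β)
    (ht : t.Nonempty) (f : ℕ → β) (hf : ∀ l ∈ s, f l ∈ t) :
    ∃ b ∈ t, (#s : ℝ) / #t ≤ #(s.filter fun l => f l = b) := by
  classical
  have htpos : (0 : ℝ) < #t := by exact_mod_cast ht.card_pos
  by_contra hcon
  push Not at hcon
  have hsum : #s = ∑ b ∈ t, #(s.filter fun l => f l = b) := card_eq_sum_card_fiberwise hf
  have hlt : ∑ b ∈ t, (#(s.filter fun l => f l = b) : ℝ) < ∑ _b ∈ t, (#s : ℝ) / #t :=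
    sum_lt_sum_of_nonempty ht fun b hb => hcon b hb
  rw [sum_const, nsmul_eq_mul, mul_div_cancel₀ _ htpos.ne'] at hlt
  have : ((#s : ℕ) : ℝ) = ∑ b ∈ t, (#(s.filter fun l => f l = b) : ℝ) := by
    rw [hsum]; push_cast; rfl
  linarith

/-! ### §3 Lemma 26 -/

/-- **Lemma 26 (GT 2008b §11, "major arcs have small second derivative"), abstract form.**
There are absolute `A ∈ ℕ`, `C ≥ 1` such that the following holds.  Let `ν` be a nonnegative,
subadditive, definite gauge with `ν 0 = 0`, `φ : ℤ → ℝ/ℤ` locally quadratic on `B(n₀,R)`,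
`0 < ρ₁`, `9ρ₁ ≤ R`, `0 < σ ≤ 1 ≤ Q`, `0 ≤ ε` with `4Qε ≤ σ`.  Let `T` be a nonempty finite set
inside `B(0,2ρ₁)` containing `𝒮 − m` whenever `ν m ≤ ρ₁`, with `σ#T ≤ #𝒮`, and suppose every
`s ∈ 𝒮` has some `1 ≤ q ≤ Q` with `‖q•φ''(s,s)‖ ≤ ε`.  Then for EVERY `h ∈ ℤ` there is
`1 ≤ q ≤ C·Q·(Q/σ)^A` with `‖q•φ''(h,h)‖ ≤ C (Q/σ)^A ν(h)²/ρ₁²`.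
(In the paper: `ρ₁ = log^{-C₂(A+1)}N`, `σ ≈ ρ₁^{3/2}`, `ε ≈ ρ₁²`, `T = B_g(0,2ρ₁)`.)
[cite: GreenTao2008QuadraticMobius, §11, Lemma 26] -/
theorem diagonal_major_arc :
    ∃ (A : ℕ) (C : ℝ), 1 ≤ C ∧
      ∀ (ν : ℤ → ℝ), ν 0 = 0 → (∀ x, 0 ≤ ν x) → (∀ x y, ν (x + y) ≤ ν x + ν y) →
        (∀ x, ν x = 0 → x = 0) →
      ∀ (φ : ℤ → UnitAddCircle) (n₀ : ℤ) (R : ℝ),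
        (∀ n a b c : ℤ, ν (n - n₀) < R → ν (n + a - n₀) < R → ν (n + b - n₀) < R →
          ν (n + c - n₀) < R → ν (n + a + b - n₀) < R → ν (n + a + c - n₀) < R →
          ν (n + b + c - n₀) < R → ν (n + a + b + c - n₀) < R →
          φ (n + a + b + c) - φ (n + a + b) - φ (n + a + c) - φ (n + b + c)
            + φ (n + a) + φ (n + b) + φ (n + c) - φ n = 0) →
      ∀ (ρ₁ σ ε Q : ℝ) (S T : Finset ℤ), 0 < ρ₁ → 9 * ρ₁ ≤ R → 0 < σ → σ ≤ 1 → 1 ≤ Q →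
        0 ≤ ε → 4 * Q * ε ≤ σ → T.Nonempty → (∀ n ∈ T, ν n < 2 * ρ₁) →
        (∀ m : ℤ, ν m ≤ ρ₁ → ∀ s ∈ S, s - m ∈ T) → σ * #T ≤ #S →
        (∀ s ∈ S, ∃ q : ℕ, 1 ≤ q ∧ (q : ℝ) ≤ Q ∧
          ‖((q : ℤ)) • (φ (n₀ + s + s) - φ (n₀ + s) - φ (n₀ + s) + φ n₀)‖ ≤ ε) →
      ∀ h : ℤ, ∃ q : ℕ, 1 ≤ q ∧ (q : ℝ) ≤ C * Q * (Q / σ) ^ A ∧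
        ‖((q : ℤ)) • (φ (n₀ + h + h) - φ (n₀ + h) - φ (n₀ + h) + φ n₀)‖ ≤
          C * (Q / σ) ^ A * ν h ^ 2 / ρ₁ ^ 2 := by
  classical
  obtain ⟨A, C, hC1, h40⟩ := exists_norm_mul_le_of_quadratic_recurrent
  refine ⟨A, 4 * C, by linarith, ?_⟩
  intro ν hν0 hνnn hνadd hνdef φ n₀ R hφ ρ₁ σ ε Q S T hρ₁ hR hσ hσ1 hQ hε hQε hT hTball hTS hσT hS h
  obtain ⟨D, hD⟩ : ∃ D : ℤ → ℤ → UnitAddCircle,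
      ∀ a b, D a b = φ (n₀ + a + b) - φ (n₀ + a) - φ (n₀ + b) + φ n₀ := ⟨_, fun _ _ => rfl⟩
  have hQσ : 1 ≤ Q / σ := by rw [le_div_iff₀ hσ]; linarith
  have hQσA : 1 ≤ (Q / σ) ^ A := one_le_pow₀ hQσ
  have hbigQ : (1 : ℝ) ≤ 4 * C * Q * (Q / σ) ^ A := by
    have : (1 : ℝ) ≤ 4 * C * Q := by nlinarith
    nlinarith
  have hnorm_half : ∀ x : UnitAddCircle, ‖x‖ ≤ 1 / 2 := fun x => by
    have := AddCircle.norm_le_half_period (1 : ℝ) (x := x) one_ne_zero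
    rwa [abs_one] at this
  -- trivial cases
  by_cases hz : ν h = 0
  · have : h = 0 := hνdef h hz
    subst this
    refine ⟨1, le_rfl, by simpa using hbigQ, ?_⟩
    simp [hz]
  have hνh : 0 < ν h := lt_of_le_of_ne (hνnn h) (Ne.symm hz)
  by_cases hbig : ρ₁ < ν h
  · refine ⟨1, le_rfl, by simpa using hbigQ, (hnorm_half _).trans ?_⟩
    rw [le_div_iff₀ (by positivity)]
    have h1 : ρ₁ ^ 2 < ν h ^ 2 := by nlinarith
    have h2 : ν h ^ 2 ≤ 4 * C * (Q / σ) ^ A * ν h ^ 2 := by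
      have : (1 : ℝ) ≤ 4 * C * (Q / σ) ^ A := by nlinarith
      nlinarith
    nlinarith [sq_nonneg ρ₁]
  push Not at hbig
  -- the main case `0 < ν h ≤ ρ₁`: `L = ⌊ρ₁/ν h⌋ ≥ 1`
  set L : ℕ := ⌊ρ₁ / ν h⌋₊ with hLdef
  have hx1 : 1 ≤ ρ₁ / ν h := by rw [le_div_iff₀ hνh]; linarith
  have hL1 : 1 ≤ L := by rw [hLdef]; exact Nat.le_floor (by exact_mod_cast hx1)
  have hLpos : (0 : ℝ) < L := by exact_mod_cast hL1
  have hLle : (L : ℝ) * ν h ≤ ρ₁ := by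
    have := Nat.floor_le (le_trans zero_le_one hx1)
    rw [hLdef]
    calc (⌊ρ₁ / ν h⌋₊ : ℝ) * ν h ≤ ρ₁ / ν h * ν h := mul_le_mul_of_nonneg_right this hνh.le
      _ = ρ₁ := div_mul_cancel₀ _ hνh.ne'
  have hLge : ρ₁ / ν h ≤ 2 * L := by
    have h1 : ρ₁ / ν h < L + 1 := by rw [hLdef]; exact Nat.lt_floor_add_one _
    have h2 : (1 : ℝ) ≤ L := by exact_mod_cast hL1
    linarith
  -- density of the translates `𝒮 − lh`, `l ≤ L`, inside `T`
  have hdens : ∀ l ∈ Icc 1 L, σ * #T ≤ #(T.filter fun n : ℤ => n + (l : ℤ) * h ∈ S) := by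
    intro l hl
    rw [mem_Icc] at hl
    have hm : ν ((l : ℤ) * h) ≤ ρ₁ := by
      refine (gauge_nsmul_le ν hν0 hνadd h l).trans ?_
      have : (l : ℝ) * ν h ≤ L * ν h :=
        mul_le_mul_of_nonneg_right (by exact_mod_cast hl.2) hνh.le
      linarith
    refine hσT.trans ?_
    have hinj : Set.InjOn (fun s : ℤ => s - (l : ℤ) * h) (S : Set ℤ) := fun a _ b _ hab => by
      simpa using hab
    have himg : S.image (fun s : ℤ => s - (l : ℤ) * h) ⊆ T.filter fun n : ℤ => n + (l : ℤ) * h ∈ S := by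
      intro x hx
      rw [mem_image] at hx
      obtain ⟨s, hs, rfl⟩ := hx
      rw [mem_filter]
      exact ⟨hTS _ hm s hs, by simpa using hs⟩
    have := card_le_card himg
    rw [card_image_of_injOn hinj] at this
    exact_mod_cast this
  obtain ⟨n, hnT, hncount⟩ := exists_base_point hT h L hdens
  have hνn : ν n < 2 * ρ₁ := hTball n hnT
  -- the denominators along the progression
  set good : Finset ℕ := (Icc 1 L).filter fun l : ℕ => n + (l : ℤ) * h ∈ S with hgood
  have hgoodS : ∀ l ∈ good, n + (l : ℤ) * h ∈ S := fun l hl => (mem_filter.1 hl).2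
  have hstep : ∀ l ∈ good, ∃ q : ℕ, (1 ≤ q ∧ (q : ℝ) ≤ Q) ∧
      ‖((q : ℤ)) • D (n + (l : ℤ) * h) (n + (l : ℤ) * h)‖ ≤ ε := by
    intro l hl
    obtain ⟨q, hq1, hqQ, hb⟩ := hS _ (hgoodS l hl)
    exact ⟨q, ⟨hq1, hqQ⟩, by rw [hD]; exact hb⟩
  choose! f hf using hstep
  set Qn : ℕ := ⌊Q⌋₊ with hQn
  have hQn1 : 1 ≤ Qn := by rw [hQn]; exact Nat.le_floor (by exact_mod_cast hQ)
  have hQnQ : (Qn : ℝ) ≤ Q := Nat.floor_le (by linarith)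
  have hft : ∀ l ∈ good, f l ∈ Icc 1 Qn := by
    intro l hl
    rw [mem_Icc]
    refine ⟨(hf l hl).1.1, ?_⟩
    rw [hQn]; exact Nat.le_floor (hf l hl).1.2
  obtain ⟨q, hqt, hqcount⟩ := exists_popular_fiber good (Icc 1 Qn)
    ⟨1, by rw [mem_Icc]; exact ⟨le_rfl, hQn1⟩⟩ f hft
  rw [mem_Icc] at hqt
  have hq1 : 1 ≤ q := hqt.1
  have hqQ : (q : ℝ) ≤ Q := le_trans (by exact_mod_cast hqt.2) hQnQ
  rw [Nat.card_Icc, show Qn + 1 - 1 = Qn by omega] at hqcount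
  -- the popular fibre has `≥ σL/Q` elements
  set good₂ : Finset ℕ := good.filter fun l => f l = q with hgood₂
  have hgood₂card : σ / Q * L ≤ #good₂ := by
    have hQnpos : (0 : ℝ) < Qn := by exact_mod_cast hQn1
    have h1 : σ * L / Qn ≤ #good₂ := by
      refine le_trans ?_ hqcount
      exact div_le_div_of_nonneg_right hncount hQnpos.le
    have h2 : σ / Q * L ≤ σ * L / Qn := by
      rw [div_mul_eq_mul_div, div_le_div_iff₀ (by positivity) hQnpos]
      have : 0 ≤ σ * L := by positivity
      nlinarith
    linarith
  -- real lifts of `φ''(n,n)`, `φ''(h,n)`, `φ''(h,h)`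
  obtain ⟨γ, hγ⟩ : ∃ γ : ℝ, ((γ : ℝ) : UnitAddCircle) = D n n := QuotientAddGroup.mk_surjective _
  obtain ⟨β, hβ⟩ : ∃ β : ℝ, ((β : ℝ) : UnitAddCircle) = D h n := QuotientAddGroup.mk_surjective _
  obtain ⟨θ, hθ⟩ : ∃ θ : ℝ, ((θ : ℝ) : UnitAddCircle) = D h h := QuotientAddGroup.mk_surjective _
  -- the quadratic structure along the progression
  have hquad : ∀ l ∈ good₂,
      ‖(((((q : ℝ) * θ) * (l : ℝ) ^ 2 + (2 * (q : ℝ) * β) * l + (q : ℝ) * γ : ℝ)) : UnitAddCircle)‖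
        ≤ ε := by
    intro l hl
    rw [hgood₂, mem_filter] at hl
    obtain ⟨hlg, hfl⟩ := hl
    have hlL : l ≤ L := (mem_Icc.1 (mem_filter.1 hlg).1).2
    have hb := (hf l hlg).2
    rw [hfl] at hb
    have hprog := second_deriv_diag_progression ν hν0 hνnn hνadd φ hφ (n := n) (h := h)
      (r := 3 * ρ₁) l (by
        have : (l : ℝ) * ν h ≤ L * ν h :=
          mul_le_mul_of_nonneg_right (by exact_mod_cast hlL) hνh.le
        linarith) (by linarith) (by linarith)
    have hDl : D (n + (l : ℤ) * h) (n + (l : ℤ) * h) =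
        ((γ : ℝ) : UnitAddCircle) + (2 * l) • ((β : ℝ) : UnitAddCircle) +
          (l * l) • ((θ : ℝ) : UnitAddCircle) := by
      rw [hD, hprog, hγ, hβ, hθ, hD, hD, hD]
    have hzq : ((q : ℕ) : ℤ) • D (n + (l : ℤ) * h) (n + (l : ℤ) * h) =
        (((((q : ℝ) * θ) * (l : ℝ) ^ 2 + (2 * (q : ℝ) * β) * l + (q : ℝ) * γ : ℝ)) :
          UnitAddCircle) := by
      rw [hDl, zsmul_coe_quadratic]; push_cast; ring_nf
    rw [← hzq]
    exact hb
  -- Lemma 40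
  have hδ₂ : 0 < σ / Q := by positivity
  have hδ₂1 : σ / Q ≤ 1 := by rw [div_le_one (by positivity)]; linarith
  have hεδ : ε ≤ σ / Q / 4 := by
    rw [le_div_iff₀ (by norm_num : (0 : ℝ) < 4), le_div_iff₀ (by positivity)]; linarith
  have hcount40 : σ / Q * L ≤ #((Icc 1 L).filter fun l : ℕ =>
      ‖((((q : ℝ) * θ) * (l : ℝ) ^ 2 + (2 * (q : ℝ) * β) * l + (q : ℝ) * γ : ℝ) :
        UnitAddCircle)‖ ≤ ε) := by
    refine hgood₂card.trans ?_
    have hsub : good₂ ⊆ (Icc 1 L).filter fun l : ℕ =>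
        ‖((((q : ℝ) * θ) * (l : ℝ) ^ 2 + (2 * (q : ℝ) * β) * l + (q : ℝ) * γ : ℝ) :
          UnitAddCircle)‖ ≤ ε := by
      intro l hl
      rw [mem_filter]
      refine ⟨?_, hquad l hl⟩
      rw [hgood₂, mem_filter, hgood, mem_filter] at hl
      exact hl.1.1
    exact_mod_cast card_le_card hsub
  obtain ⟨q', hq'1, hq'C, hq'b⟩ :=
    h40 ((q : ℝ) * θ) (2 * (q : ℝ) * β) ((q : ℝ) * γ) L ε (σ / Q) hδ₂ hδ₂1 hε hεδ hL1 hcount40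
  have hinv : (1 : ℝ) / (σ / Q) ^ A = (Q / σ) ^ A := by
    rw [one_div, ← inv_pow, inv_div]
  -- the denominator `q' q`
  refine ⟨q' * q, Nat.one_le_iff_ne_zero.2 (Nat.mul_ne_zero (by omega) (by omega)), ?_, ?_⟩
  · push_cast
    have h1 : (q' : ℝ) ≤ C * (Q / σ) ^ A := by
      rw [← hinv, mul_one_div]; exact hq'C
    calc (q' : ℝ) * q ≤ C * (Q / σ) ^ A * Q := mul_le_mul h1 hqQ (by positivity) (by positivity)
      _ ≤ 4 * C * Q * (Q / σ) ^ A := by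
          have : 0 ≤ C * (Q / σ) ^ A * Q := by positivity
          nlinarith
  · have hz : (((q' * q : ℕ)) : ℤ) • D h h = ((((q' : ℝ) * ((q : ℝ) * θ) : ℝ)) : UnitAddCircle) := by
      rw [← hθ, ← AddCircle.coe_zsmul]
      congr 1
      rw [zsmul_eq_mul]; push_cast; ring
    rw [← hD, hz]
    refine hq'b.trans ?_
    -- `C/((σ/Q)^A L²) ≤ 4C (Q/σ)^A ν h²/ρ₁²` as `ρ₁/ν h ≤ 2L`
    have hσQA : 0 < (σ / Q) ^ A := pow_pos hδ₂ _
    rw [div_le_div_iff₀ (by positivity) (by positivity)]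
    have e1 : 4 * C * (Q / σ) ^ A * ν h ^ 2 * ((σ / Q) ^ A * (L : ℝ) ^ 2) =
        C * (2 * L * ν h) ^ 2 * ((Q / σ) ^ A * (σ / Q) ^ A) := by ring
    have e2 : (Q / σ) ^ A * (σ / Q) ^ A = 1 := by
      rw [← mul_pow, div_mul_div_comm, mul_comm Q σ, div_self (by positivity), one_pow]
    rw [e1, e2, mul_one]
    have h3 : ρ₁ ≤ 2 * L * ν h := by
      have := mul_le_mul_of_nonneg_right hLge hνh.le
      rwa [div_mul_cancel₀ _ hνh.ne'] at this
    have h4 : ρ₁ ^ 2 ≤ (2 * L * ν h) ^ 2 := pow_le_pow_left₀ hρ₁.le h3 2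
    have hC0 : 0 ≤ C := by linarith
    exact mul_le_mul_of_nonneg_left h4 hC0

end Summit.Parity.GeneralizedHardyLittlewood.GreenTaoLevelTwoMNTwoDiagonalMajorArc
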